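import Mathlib
import Literature.Probability.LatticeModels.BinomialEntropy
import Summits.PneNP.PneNP.Theorems.OverlapGapAlgebraNoStableSectionDefs

/-!
# Route OverlapGapAlgebra, crux `NoStableSection` (stmt-PneNP-2462), line `DartGame`: stub C

**Counting by conditional type entropy** (method of types, Cover–Thomas Thm. 11.1.3, as used by
Bresler–Huang, arXiv:2106.02129, §4.6 and Lemma 5.1, with the `o(n)` terms replaced by exact
inequalities):

1. `card_filter_condEnt_le`: for a fixed prefix `R` of `ℓ` rungs, the candidates `v` of conditional
   type entropy `condEnt (withRung R ℓ v) ℓ ≤ b` number at most `(n+1)^(2^ℓ) · exp(n b)`: classify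
   `v` by its refined count vector `c_v ξ = #{i ∈ class ξ | v i = true}`; a fibre has at most
   `Π_ξ C(N_ξ, c_ξ) ≤ exp(Σ_ξ N_ξ h₂(c_ξ/N_ξ)) = exp(n · condEnt)` elements
   (`C(N, j) ≤ exp(N h₂(j/N))`, from `Literature.Probability.LatticeModels.choose_le_exp_spinRate`),
   and there are at most `(n+1)^(2^ℓ)` count vectors.
2. `card_filter_tuple_condEnt_le`: iterating rung by rung, the tuples `(y⁰, …, y^L)` all of whose
   rungs `ℓ ≥ 1` have conditional type entropy `≤ b` number at most `2^n ((n+1)^(2^L) e^{nb})^L`.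

The conjunction `stub_condEntCount` is the body of the skeleton's `CondEntCount`; the vocabulary
(`patCount`, `condEnt`, `withRung`, `seqOf`, …) is that of
`Summits.PneNP.PneNP.Theorems.OverlapGapAlgebraNoStableSectionDefs`.
-/

namespace Summit.PneNP.PneNP.Cruxes.NoStableSection.DartGame

set_option linter.dupNamespace false

/-! ## Stub C: counting by conditional type entropy -/

section Count

open Finset Real

variable {n : ℕ}

/-- The crude entropy bound for a binomial coefficient in `binEntropy` form:
`C(N, j) ≤ exp(N · h₂(j/N))` for `0 ≤ j ≤ N` (at `N = 0` both sides are `1`). -/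
theorem cnt_choose_le_exp_binEntropy {N j : ℕ} (hjN : j ≤ N) :
    (N.choose j : ℝ) ≤ Real.exp (N * binEntropy ((j : ℝ) / N)) := by
  rcases Nat.eq_zero_or_pos N with rfl | hN
  · obtain rfl : j = 0 := Nat.le_zero.1 hjN
    simp
  have hN' : (0 : ℝ) < N := by exact_mod_cast hN
  have h := Literature.Probability.LatticeModels.choose_le_exp_spinRate hjN
  rw [Literature.Probability.LatticeModels.spinRate_eq_log_two_sub_binEntropy] at h
  have e : (1 + (2 * (j : ℝ) - N) / N) / 2 = (j : ℝ) / N := by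
    field_simp
    ring
  rw [e] at h
  have h2 : Real.exp ((N : ℝ) * Real.log 2) = 2 ^ N := by
    rw [Real.exp_nat_mul, Real.exp_log two_pos]
  calc (N.choose j : ℝ) ≤ 2 ^ N * Real.exp (-(N * (Real.log 2 - binEntropy ((j : ℝ) / N)))) := h
    _ = Real.exp (N * binEntropy ((j : ℝ) / N)) := by
      rw [show -((N : ℝ) * (Real.log 2 - binEntropy ((j : ℝ) / N))) =
          N * binEntropy ((j : ℝ) / N) - N * Real.log 2 by ring, Real.exp_sub, h2]
      field_simp

/-- A pattern class has at most `n` positions. -/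
theorem cnt_patCount_le (Y : ℕ → Fin n → Bool) (ℓ : ℕ) (ξ : Fin ℓ → Bool) : patCount Y ℓ ξ ≤ n := by
  unfold patCount
  calc (univ.filter fun i : Fin n => (fun j : Fin ℓ => Y j i) = ξ).card
      ≤ (univ : Finset (Fin n)).card := card_filter_le _ _
    _ = n := by rw [card_univ, Fintype.card_fin]

/-- The class sizes `N_ξ` of the prefix do not depend on the inserted candidate. -/
theorem cnt_patCount_withRung (R : ℕ → Fin n → Bool) (ℓ : ℕ) (v : Fin n → Bool)
    (ξ : Fin ℓ → Bool) :
    patCount (withRung R ℓ v) ℓ ξ =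
      (univ.filter fun i : Fin n => (fun j : Fin ℓ => R j i) = ξ).card :=
  patCount_congr (fun _ hj => withRung_of_lt R ℓ v hj) ξ

/-- The refined class `ξ·true` of `withRung R ℓ v`: the positions of class `ξ` where `v` is true. -/
theorem cnt_patCount_withRung_succ (R : ℕ → Fin n → Bool) (ℓ : ℕ) (v : Fin n → Bool)
    (ξ : Fin ℓ → Bool) :
    patCount (withRung R ℓ v) (ℓ + 1) (Fin.snoc ξ true) =
      (univ.filter fun i : Fin n => (fun j : Fin ℓ => R j i) = ξ ∧ v i = true).card := by
  unfold patCount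
  congr 1
  ext i
  simp only [mem_filter, mem_univ, true_and]
  constructor
  · intro h
    refine ⟨?_, ?_⟩
    · funext j
      have := congrFun h (Fin.castSucc j)
      simp only [Fin.snoc_castSucc, Fin.val_castSucc] at this
      rwa [withRung_of_lt R ℓ v j.isLt] at this
    · have := congrFun h (Fin.last ℓ)
      simp only [Fin.snoc_last, Fin.val_last] at this
      rwa [withRung_self] at this
  · rintro ⟨h1, h2⟩
    funext j
    refine Fin.lastCases ?_ (fun j => ?_) j
    · simp only [Fin.snoc_last, Fin.val_last, withRung_self]
      exact h2
    · simp only [Fin.snoc_castSucc, Fin.val_castSucc]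
      rw [withRung_of_lt R ℓ v j.isLt]
      exact congrFun h1 j

/-- Candidates with a prescribed refined count vector number at most `Π_ξ C(N_ξ, c_ξ)`: a candidate
is determined by its true-sets inside the classes, which form an element of
`Π_ξ powersetCard c_ξ (class ξ)`. -/
theorem cnt_card_fiber_le (R : ℕ → Fin n → Bool) (ℓ : ℕ) (v₀ : Fin n → Bool) :
    (univ.filter fun v : Fin n → Bool => ∀ ξ : Fin ℓ → Bool,
        patCount (withRung R ℓ v) (ℓ + 1) (Fin.snoc ξ true) =
          patCount (withRung R ℓ v₀) (ℓ + 1) (Fin.snoc ξ true)).card ≤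
      ∏ ξ : Fin ℓ → Bool, (patCount (withRung R ℓ v₀) ℓ ξ).choose
        (patCount (withRung R ℓ v₀) (ℓ + 1) (Fin.snoc ξ true)) := by
  classical
  calc (univ.filter fun v : Fin n → Bool => ∀ ξ : Fin ℓ → Bool,
        patCount (withRung R ℓ v) (ℓ + 1) (Fin.snoc ξ true) =
          patCount (withRung R ℓ v₀) (ℓ + 1) (Fin.snoc ξ true)).card
      ≤ (Fintype.piFinset fun ξ : Fin ℓ → Bool =>
          powersetCard (patCount (withRung R ℓ v₀) (ℓ + 1) (Fin.snoc ξ true))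
            (univ.filter fun i : Fin n => (fun j : Fin ℓ => R j i) = ξ)).card := by
        refine card_le_card_of_injOn (fun (v : Fin n → Bool) (ξ : Fin ℓ → Bool) =>
          univ.filter fun i : Fin n => (fun j : Fin ℓ => R j i) = ξ ∧ v i = true) ?_ ?_
        · -- maps into the product of the `powersetCard`s
          intro v hv
          rw [mem_coe, mem_filter] at hv
          rw [mem_coe, Fintype.mem_piFinset]
          intro ξ
          rw [mem_powersetCard]
          refine ⟨?_, ?_⟩
          · intro i hi
            rw [mem_filter] at hi ⊢
            exact ⟨hi.1, hi.2.1⟩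
          · rw [← hv.2 ξ, cnt_patCount_withRung_succ]
        · -- injective: `v i` is read off the true-set of the class of `i`
          intro v _ v' _ h
          funext i
          have key : ∀ w : Fin n → Bool,
              (i ∈ univ.filter fun i' : Fin n =>
                (fun j : Fin ℓ => R j i') = (fun j : Fin ℓ => R j i) ∧ w i' = true) ↔ w i = true :=
            fun w => by simp
          have h' := congrFun h (fun j : Fin ℓ => R j i)
          simp only at h'
          have h1 := key v
          rw [h', key v'] at h1
          exact Bool.eq_iff_iff.2 h1.symm
    _ = ∏ ξ : Fin ℓ → Bool, (patCount (withRung R ℓ v₀) ℓ ξ).choose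
          (patCount (withRung R ℓ v₀) (ℓ + 1) (Fin.snoc ξ true)) := by
        rw [Fintype.card_piFinset]
        refine prod_congr rfl fun ξ _ => ?_
        rw [card_powersetCard, cnt_patCount_withRung]

/-- The entropy bound on a fibre: `Π_ξ C(N_ξ, c_ξ) ≤ exp(n · condEnt)` (per class
`C(N, c) ≤ exp(N h₂(c/N))`, and `Σ_ξ N_ξ h₂(c_ξ/N_ξ) = n · condEnt` by
`condEnt_eq_sum_binEntropy`). -/
theorem cnt_prod_choose_le_exp (R : ℕ → Fin n → Bool) (ℓ : ℕ) (v₀ : Fin n → Bool) :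
    ((∏ ξ : Fin ℓ → Bool, (patCount (withRung R ℓ v₀) ℓ ξ).choose
        (patCount (withRung R ℓ v₀) (ℓ + 1) (Fin.snoc ξ true)) : ℕ) : ℝ) ≤
      Real.exp (n * condEnt (withRung R ℓ v₀) ℓ) := by
  rw [condEnt_eq_sum_binEntropy, mul_sum, Real.exp_sum, Nat.cast_prod]
  refine prod_le_prod (fun ξ _ => by positivity) fun ξ _ => ?_
  have hsplit := patCount_succ_eq (withRung R ℓ v₀) ℓ ξ
  have hNn := cnt_patCount_le (withRung R ℓ v₀) ℓ ξ
  set N : ℕ := patCount (withRung R ℓ v₀) ℓ ξ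
  set A : ℕ := patCount (withRung R ℓ v₀) (ℓ + 1) (Fin.snoc ξ true)
  have hAN : A ≤ N := by omega
  calc (N.choose A : ℝ)
      ≤ Real.exp (N * binEntropy ((A : ℝ) / N)) := cnt_choose_le_exp_binEntropy hAN
    _ = Real.exp (n * (((N : ℝ) / n) * binEntropy ((A : ℝ) / N))) := by
      congr 1
      rcases Nat.eq_zero_or_pos n with hn | hn
      · have hN0 : N = 0 := by omega
        simp [hN0, hn]
      · have hn' : (n : ℝ) ≠ 0 := by exact_mod_cast hn.ne'
        field_simp

/-- **Stub C (1)**: for a fixed prefix, the candidates of conditional type entropy `≤ b` number at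
most `(n+1)^(2^ℓ) · exp(n b)` (BH §4.6, the count behind `S_indep`, made exact). -/
theorem card_filter_condEnt_le (n ℓ : ℕ) (R : ℕ → Fin n → Bool) (b : ℝ) :
    ((Finset.univ.filter fun v : Fin n → Bool => condEnt (withRung R ℓ v) ℓ ≤ b).card : ℝ) ≤
      ((n : ℝ) + 1) ^ (2 ^ ℓ) * Real.exp (n * b) := by
  classical
  set S := Finset.univ.filter fun v : Fin n → Bool => condEnt (withRung R ℓ v) ℓ ≤ b with hS
  -- the refined count vector of a candidate
  set f : (Fin n → Bool) → (Fin ℓ → Bool) → ℕ :=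
    fun v ξ => patCount (withRung R ℓ v) (ℓ + 1) (Fin.snoc ξ true)
  have h1 : S.card = ∑ c ∈ S.image f, (S.filter fun v => f v = c).card :=
    card_eq_sum_card_image f S
  -- each fibre is small
  have h2 : ∀ c ∈ S.image f, ((S.filter fun v => f v = c).card : ℝ) ≤ Real.exp (n * b) := by
    intro c hc
    obtain ⟨v₀, hv₀, rfl⟩ := mem_image.1 hc
    have hb : condEnt (withRung R ℓ v₀) ℓ ≤ b := by
      rw [hS, mem_filter] at hv₀
      exact hv₀.2
    have hsub : (S.filter fun v => f v = f v₀) ⊆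
        (univ.filter fun v : Fin n → Bool => ∀ ξ : Fin ℓ → Bool,
          patCount (withRung R ℓ v) (ℓ + 1) (Fin.snoc ξ true) =
            patCount (withRung R ℓ v₀) (ℓ + 1) (Fin.snoc ξ true)) := by
      intro v hv
      rw [mem_filter] at hv
      rw [mem_filter]
      exact ⟨mem_univ _, fun ξ => congrFun hv.2 ξ⟩
    calc ((S.filter fun v => f v = f v₀).card : ℝ)
        ≤ ((univ.filter fun v : Fin n → Bool => ∀ ξ : Fin ℓ → Bool,
            patCount (withRung R ℓ v) (ℓ + 1) (Fin.snoc ξ true) =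
              patCount (withRung R ℓ v₀) (ℓ + 1) (Fin.snoc ξ true)).card : ℝ) := by
          exact_mod_cast card_le_card hsub
      _ ≤ ((∏ ξ : Fin ℓ → Bool, (patCount (withRung R ℓ v₀) ℓ ξ).choose
            (patCount (withRung R ℓ v₀) (ℓ + 1) (Fin.snoc ξ true)) : ℕ) : ℝ) := by
          exact_mod_cast cnt_card_fiber_le R ℓ v₀
      _ ≤ Real.exp (n * condEnt (withRung R ℓ v₀) ℓ) := cnt_prod_choose_le_exp R ℓ v₀
      _ ≤ Real.exp (n * b) :=
          Real.exp_le_exp.2 (mul_le_mul_of_nonneg_left hb (Nat.cast_nonneg n))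
  -- and there are few count vectors
  have h3 : (S.image f).card ≤ (n + 1) ^ 2 ^ ℓ := by
    calc (S.image f).card
        ≤ (Fintype.piFinset fun _ : Fin ℓ → Bool => range (n + 1)).card := by
          refine card_le_card fun c hc => ?_
          obtain ⟨v, _, rfl⟩ := mem_image.1 hc
          rw [Fintype.mem_piFinset]
          intro ξ
          rw [mem_range]
          exact Nat.lt_succ_of_le (cnt_patCount_le _ _ _)
      _ = (n + 1) ^ 2 ^ ℓ := by
          rw [Fintype.card_piFinset, prod_const, card_range, card_univ, Fintype.card_fun,
            Fintype.card_fin, Fintype.card_bool]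
  calc (S.card : ℝ) = ∑ c ∈ S.image f, ((S.filter fun v => f v = c).card : ℝ) := by
        rw [h1]
        push_cast
        rfl
    _ ≤ ∑ c ∈ S.image f, Real.exp (n * b) := sum_le_sum h2
    _ = (S.image f).card * Real.exp (n * b) := by rw [sum_const, nsmul_eq_mul]
    _ ≤ ((n : ℝ) + 1) ^ (2 ^ ℓ) * Real.exp (n * b) := by
        gcongr
        exact_mod_cast h3

/-- Dropping the last entry of a tuple does not change the sequence below it. -/
theorem cnt_seqOf_init {L : ℕ} (Y : Fin (L + 1) → Fin n → Bool) {j : ℕ} (hj : j < L) :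
    seqOf (Fin.init Y) j = seqOf Y j := by
  rw [seqOf_apply_lt _ hj, seqOf_apply_lt _ (Nat.lt_succ_of_lt hj)]
  rfl

/-- The conditional entropies of the rungs below the last one are those of the truncated tuple. -/
theorem cnt_condEnt_seqOf_init {L : ℕ} (Y : Fin (L + 1) → Fin n → Bool) {ℓ : ℕ} (hℓ : ℓ < L) :
    condEnt (seqOf (Fin.init Y)) ℓ = condEnt (seqOf Y) ℓ :=
  condEnt_congr fun _ hj => cnt_seqOf_init Y (by omega)

/-- The conditional entropy of the last rung is that of the last entry as a candidate over the
truncated tuple. -/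
theorem cnt_condEnt_seqOf_last {L : ℕ} (Y : Fin (L + 1) → Fin n → Bool) :
    condEnt (seqOf Y) L = condEnt (withRung (seqOf (Fin.init Y)) L (Y (Fin.last L))) L := by
  refine condEnt_congr fun j hj => ?_
  rcases Nat.lt_or_ge j L with h | h
  · rw [withRung_of_lt _ _ _ h, cnt_seqOf_init Y h]
  · have hjL : j = L := le_antisymm hj h
    subst hjL
    rw [withRung_self, seqOf_apply_lt Y (Nat.lt_succ_self j)]
    rfl

/-- **Stub C (2)**: the tuples `(y⁰, …, y^L)` all of whose rungs `ℓ ≥ 1` have conditional type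
entropy `≤ b` number at most `2^n ((n+1)^(2^L) e^{nb})^L` (BH Lemma 5.1, the count of admissible
ladders, made exact; by induction on `L`, peeling the last rung and applying (1)). -/
theorem card_filter_tuple_condEnt_le (n L : ℕ) (b : ℝ) (_hb : 0 ≤ b) :
    ((Finset.univ.filter fun Y : Fin (L + 1) → (Fin n → Bool) =>
        ∀ ℓ : Fin (L + 1), 1 ≤ (ℓ : ℕ) → condEnt (seqOf Y) ℓ ≤ b).card : ℝ) ≤
      (2 : ℝ) ^ n * (((n : ℝ) + 1) ^ (2 ^ L) * Real.exp (n * b)) ^ L := by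
  classical
  induction L with
  | zero =>
    have hall : (Finset.univ.filter fun Y : Fin (0 + 1) → (Fin n → Bool) =>
        ∀ ℓ : Fin (0 + 1), 1 ≤ (ℓ : ℕ) → condEnt (seqOf Y) ℓ ≤ b) = univ := by
      refine filter_true_of_mem fun Y _ => ?_
      intro ℓ hℓ
      exact absurd ℓ.isLt (by omega)
    have hc : Fintype.card (Fin (0 + 1) → Fin n → Bool) = 2 ^ n := by
      rw [Fintype.card_fun, Fintype.card_fun, Fintype.card_bool, Fintype.card_fin,
        Fintype.card_fin, pow_one]
    rw [hall, card_univ, hc, pow_zero, mul_one]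
    push_cast
    exact le_rfl
  | succ L ih =>
    set T' := Finset.univ.filter fun Y : Fin (L + 1 + 1) → (Fin n → Bool) =>
        ∀ ℓ : Fin (L + 1 + 1), 1 ≤ (ℓ : ℕ) → condEnt (seqOf Y) ℓ ≤ b with hT'
    set T := Finset.univ.filter fun Y : Fin (L + 1) → (Fin n → Bool) =>
        ∀ ℓ : Fin (L + 1), 1 ≤ (ℓ : ℕ) → condEnt (seqOf Y) ℓ ≤ b with hT
    -- (a) truncation maps good tuples to good tuples
    have hmaps : (T' : Set (Fin (L + 1 + 1) → (Fin n → Bool))).MapsTo (fun Y => Fin.init Y) T := by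
      intro Y hY
      rw [mem_coe, hT', mem_filter] at hY
      rw [mem_coe, hT, mem_filter]
      refine ⟨mem_univ _, fun ℓ hℓ => ?_⟩
      rw [cnt_condEnt_seqOf_init Y ℓ.isLt]
      have := hY.2 (Fin.castSucc ℓ) (by simpa using hℓ)
      simpa using this
    -- (b) count fibrewise over the truncation
    have hsum : T'.card = ∑ Y' ∈ T, (T'.filter fun Y => Fin.init Y = Y').card :=
      card_eq_sum_card_fiberwise hmaps
    -- (c) a fibre injects (by the last entry) into the good candidates over the prefix,
    -- which (1) counts
    have hfib : ∀ Y' ∈ T, ((T'.filter fun Y => Fin.init Y = Y').card : ℝ) ≤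
        ((n : ℝ) + 1) ^ (2 ^ (L + 1)) * Real.exp (n * b) := by
      intro Y' _
      calc ((T'.filter fun Y => Fin.init Y = Y').card : ℝ)
          ≤ ((univ.filter fun v : Fin n → Bool =>
              condEnt (withRung (seqOf Y') (L + 1) v) (L + 1) ≤ b).card : ℝ) := by
            have h := card_le_card_of_injOn (s := T'.filter fun Y => Fin.init Y = Y')
              (t := univ.filter fun v : Fin n → Bool =>
                condEnt (withRung (seqOf Y') (L + 1) v) (L + 1) ≤ b)
              (fun Y => Y (Fin.last (L + 1))) ?_ ?_
            · exact_mod_cast h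
            · intro Y hY
              rw [mem_coe, mem_filter] at hY
              obtain ⟨hY, hYi⟩ := hY
              rw [hT', mem_filter] at hY
              rw [mem_coe, mem_filter]
              refine ⟨mem_univ _, ?_⟩
              have := hY.2 (Fin.last (L + 1)) (by simp)
              rw [Fin.val_last, cnt_condEnt_seqOf_last Y, hYi] at this
              exact this
            · intro Y₁ h₁ Y₂ h₂ h
              rw [mem_coe, mem_filter] at h₁ h₂
              have h' : Y₁ (Fin.last (L + 1)) = Y₂ (Fin.last (L + 1)) := h
              rw [← Fin.snoc_init_self Y₁, ← Fin.snoc_init_self Y₂, h₁.2, h₂.2, h']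
        _ ≤ ((n : ℝ) + 1) ^ (2 ^ (L + 1)) * Real.exp (n * b) :=
            card_filter_condEnt_le n (L + 1) (seqOf Y') b
    -- (d) assemble with the induction hypothesis
    have hmono : ((n : ℝ) + 1) ^ (2 ^ L) * Real.exp (n * b) ≤
        ((n : ℝ) + 1) ^ (2 ^ (L + 1)) * Real.exp (n * b) := by
      have h2L : 2 ^ L ≤ 2 ^ (L + 1) := Nat.pow_le_pow_right (by norm_num) (Nat.le_succ L)
      have hn1 : (1 : ℝ) ≤ (n : ℝ) + 1 := by linarith [(Nat.cast_nonneg n : (0 : ℝ) ≤ n)]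
      exact mul_le_mul_of_nonneg_right (pow_le_pow_right₀ hn1 h2L) (Real.exp_pos _).le
    calc (T'.card : ℝ) = ∑ Y' ∈ T, ((T'.filter fun Y => Fin.init Y = Y').card : ℝ) := by
          rw [hsum]
          push_cast
          rfl
      _ ≤ ∑ Y' ∈ T, ((n : ℝ) + 1) ^ (2 ^ (L + 1)) * Real.exp (n * b) := sum_le_sum hfib
      _ = T.card * (((n : ℝ) + 1) ^ (2 ^ (L + 1)) * Real.exp (n * b)) := by
          rw [sum_const, nsmul_eq_mul]
      _ ≤ (2 : ℝ) ^ n * (((n : ℝ) + 1) ^ (2 ^ L) * Real.exp (n * b)) ^ L *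
            (((n : ℝ) + 1) ^ (2 ^ (L + 1)) * Real.exp (n * b)) := by
          gcongr
      _ ≤ (2 : ℝ) ^ n * (((n : ℝ) + 1) ^ (2 ^ (L + 1)) * Real.exp (n * b)) ^ L *
            (((n : ℝ) + 1) ^ (2 ^ (L + 1)) * Real.exp (n * b)) := by
          gcongr
      _ = (2 : ℝ) ^ n * (((n : ℝ) + 1) ^ (2 ^ (L + 1)) * Real.exp (n * b)) ^ (L + 1) := by
          ring

/-- **Stub C** (`CondEntCount` of the skeleton): the conjunction of `card_filter_condEnt_le` and
`card_filter_tuple_condEnt_le`. -/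
theorem stub_condEntCount :
    (∀ (n ℓ : ℕ) (R : ℕ → Fin n → Bool) (b : ℝ),
        ((Finset.univ.filter fun v : Fin n → Bool => condEnt (withRung R ℓ v) ℓ ≤ b).card : ℝ) ≤
          ((n : ℝ) + 1) ^ (2 ^ ℓ) * Real.exp (n * b)) ∧
    (∀ (n L : ℕ) (b : ℝ), 0 ≤ b →
        ((Finset.univ.filter fun Y : Fin (L + 1) → (Fin n → Bool) =>
            ∀ ℓ : Fin (L + 1), 1 ≤ (ℓ : ℕ) → condEnt (seqOf Y) ℓ ≤ b).card : ℝ) ≤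
          (2 : ℝ) ^ n * (((n : ℝ) + 1) ^ (2 ^ L) * Real.exp (n * b)) ^ L) :=
  ⟨card_filter_condEnt_le, card_filter_tuple_condEnt_le⟩

end Count

end Summit.PneNP.PneNP.Cruxes.NoStableSection.DartGame
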